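import Summits.CriticalPhenomena.SAWScalingLimit.Theorems.SAWDefectDecoherenceBoundaryClosureRBoundaryExactnessZigzag
import HarnessLib

/-!
# Crux `BoundaryClosureR` (stmt-CriticalPhenomena-14004), line `polygon-parity-squeeze`,
# stub `stub_innerPolygons` (IP): walks from the root to the normaliser exist in every
# preconnected domain

Landing target:
`Summits/CriticalPhenomena/SAWScalingLimit/Theorems/SAWDefectDecoherenceBoundaryClosureRInnerPolygonsWalks.lean`
(`--supports stmt-CriticalPhenomena-14004`; building block of the registered stub `stub_innerPolygons`,
hypothesis (IP) of the landed squeeze `PolygonParitySqueeze.squeeze_of_innerPolygons`).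

The clause `Nonempty (HexMidEdgeSAW (Λ^P δ) (a δ) (b δ))` of `PinnedFlatRoot P Λ^P b (pt 0) a …` for
the inner polygon family `Λ^P` is pure graph theory once `Λ^P δ` is known to be preconnected with
`a δ, b δ ∈ ∂Ω(Λ^P δ)` (landed: `eventually_sandwich_frame`): a simple path of the induced graph
between the inner endpoints of two DISTINCT boundary mid-edges is the vertex list of a self-avoiding
walk between them (`PickHalfPlane.BoundaryExactness.exists_mkWalk`).

* `exists_list_path_of_preconnected` — a simple path of `ℍ[Λ]` between two vertices of `Λ`, as a
  nonempty duplicate-free `hexGraph`-chain of `Λ` with prescribed ends (Mathlib's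
  `Preconnected.exists_isPath`, pushed to `ℍ` along the induced embedding);
* `nonempty_hexMidEdgeSAW_of_preconnected` — **walks exist**: `Λ` preconnected, `a ≠ b` boundary
  mid-edges `⟹ Nonempty (HexMidEdgeSAW Λ a b)`;
* `eventually_nonempty_hexMidEdgeSAW` — the family form: roots and normalisers converging to two
  DISTINCT points are eventually distinct, so the walks exist eventually.

Sources: H. Duminil-Copin, S. Smirnov, Ann. of Math. 175 (2012) §2 (domains, walks between
mid-edges).  No definition and no named fact is introduced.
-/

noncomputable section

open scoped Topology
open Filter Set
open Literature.Probability.LatticeModels (HexVertex hexGraph)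
open Literature.Probability.RandomPlanarGeometry
open Literature.Probability.RandomPlanarGeometry.SAW
open Summit.CriticalPhenomena.SAWScalingLimit.Theorems.PickHalfPlane.BoundaryExactness (exists_mkWalk)

namespace Summit.CriticalPhenomena.SAWScalingLimit.Theorems.PolygonParitySqueeze

/-- **A simple path of `ℍ[Λ]` as a vertex list**: in a preconnected induced subgraph `ℍ[Λ]`, any two
vertices `v, v' ∈ Λ` are the ends of a nonempty duplicate-free `hexGraph`-chain of vertices of `Λ`.
[folklore] -/
theorem exists_list_path_of_preconnected (Λ : Finset HexVertex)
    (hΛ : (hexGraph.induce ((Λ : Finset HexVertex) : Set HexVertex)).Preconnected)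
    {v v' : HexVertex} (hv : v ∈ Λ) (hv' : v' ∈ Λ) :
    ∃ (L : List HexVertex) (hL : L ≠ []), L.head hL = v ∧ L.getLast hL = v' ∧
      (∀ x ∈ L, x ∈ Λ) ∧ L.Nodup ∧ L.IsChain hexGraph.Adj := by
  obtain ⟨p, hp⟩ := hΛ.exists_isPath ⟨v, hv⟩ ⟨v', hv'⟩
  set f : hexGraph.induce ((Λ : Finset HexVertex) : Set HexVertex) →g hexGraph :=
    (SimpleGraph.Embedding.induce ((Λ : Finset HexVertex) : Set HexVertex)).toHom with hf
  have hinj : Function.Injective f := fun x y h => Subtype.ext h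
  refine ⟨(p.map f).support, (p.map f).support_ne_nil, (p.map f).head_support,
    (p.map f).getLast_support, ?_, ?_, (p.map f).isChain_adj_support⟩
  · intro x hx
    rw [SimpleGraph.Walk.support_map, List.mem_map] at hx
    obtain ⟨y, -, rfl⟩ := hx
    exact y.2
  · exact ((SimpleGraph.Walk.isPath_map_iff_of_injective hinj).2 hp).support_nodup

/-- **Walks exist in preconnected domains** (sub-goal of `stub_innerPolygons`, clause
`Nonempty (HexMidEdgeSAW …)` of `PinnedFlatRoot` for the inner polygon family): if `ℍ[Λ]` is
preconnected and `a ≠ b` are boundary mid-edges of `Λ`, there is a self-avoiding walk `a → b` in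
`Ω(Λ)` — the vertex list of a simple path of `ℍ[Λ]` between the inner endpoints (the inner edges
join vertices of `Λ`, while `a`, `b` contain a vertex off `Λ`, so no edge repeats).
[cite: DuminilCopinSmirnov2012, §2 (walks between mid-edges of a domain)] -/
theorem nonempty_hexMidEdgeSAW_of_preconnected : ∀ (Λ : Finset HexVertex) (a b : Sym2 HexVertex), (hexGraph.induce ((Λ : Finset HexVertex) : Set HexVertex)).Preconnected → a ∈ hexDomainBoundary Λ → b ∈ hexDomainBoundary Λ → a ≠ b → Nonempty (HexMidEdgeSAW Λ a b) := by
  intro Λ a b hΛ ha hb hab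
  obtain ⟨hae, u, v, rfl, hv, hu⟩ := ha
  obtain ⟨-, u', v', rfl, hv', hu'⟩ := hb
  obtain ⟨L, hL, hhead, hlast, hsub, hnd, hch⟩ := exists_list_path_of_preconnected Λ hΛ hv hv'
  have hua : hexGraph.Adj u (L.head hL) := by
    rw [hhead]
    exact (SimpleGraph.mem_edgeSet hexGraph).1 hae
  obtain ⟨γ, -⟩ := exists_mkWalk s(u, v) s(u', v') u L u' hL (by rw [hhead]) (by rw [hlast]) hsub
    hnd hch hu hua hu' hab
  exact ⟨γ⟩

/-- **Roots and normalisers converging to distinct points are eventually distinct**: if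
`δ·mid(a δ) → x`, `δ·mid(b δ) → y` along `δ → 0⁺` and `x ≠ y`, then eventually `a δ ≠ b δ`.
[folklore] -/
theorem eventually_ne_of_tendsto_midpoint : ∀ (a b : ℝ → Sym2 HexVertex) (x y : ℂ), x ≠ y → Tendsto (fun δ : ℝ => (δ : ℂ) * hexMidpoint (a δ)) (𝓝[>] 0) (𝓝 x) → Tendsto (fun δ : ℝ => (δ : ℂ) * hexMidpoint (b δ)) (𝓝[>] 0) (𝓝 y) → ∀ᶠ δ : ℝ in 𝓝[>] 0, a δ ≠ b δ := by
  intro a b x y hxy ha hb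
  have hd : 0 < dist x y / 2 := half_pos (dist_pos.2 hxy)
  filter_upwards [ha (Metric.ball_mem_nhds x hd), hb (Metric.ball_mem_nhds y hd)] with δ h1 h2 heq
  rw [Set.mem_preimage, Metric.mem_ball] at h1 h2
  rw [heq] at h1
  have := dist_triangle_left x y ((δ : ℂ) * hexMidpoint (b δ))
  linarith

/-- **Walks exist, eventually** (family form for the inner polygon family `Λ'`): if the root
mid-edges `a δ` and the normalisers `b δ` converge (scaled) to two distinct points and eventually
`ℍ[Λ' δ]` is preconnected with `a δ, b δ ∈ ∂Ω(Λ' δ)`, then eventually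
`Nonempty (HexMidEdgeSAW (Λ' δ) (a δ) (b δ))`.
[cite: DuminilCopinSmirnov2012, §2 (walks between mid-edges of a domain)] -/
theorem eventually_nonempty_hexMidEdgeSAW : ∀ (Λ' : ℝ → Finset HexVertex) (a b : ℝ → Sym2 HexVertex) (x y : ℂ), x ≠ y → Tendsto (fun δ : ℝ => (δ : ℂ) * hexMidpoint (a δ)) (𝓝[>] 0) (𝓝 x) → Tendsto (fun δ : ℝ => (δ : ℂ) * hexMidpoint (b δ)) (𝓝[>] 0) (𝓝 y) → (∀ᶠ δ : ℝ in 𝓝[>] 0, (hexGraph.induce ((Λ' δ : Finset HexVertex) : Set HexVertex)).Preconnected ∧ a δ ∈ hexDomainBoundary (Λ' δ) ∧ b δ ∈ hexDomainBoundary (Λ' δ)) → ∀ᶠ δ : ℝ in 𝓝[>] 0, Nonempty (HexMidEdgeSAW (Λ' δ) (a δ) (b δ)) := by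
  intro Λ' a b x y hxy ha hb hev
  filter_upwards [hev, eventually_ne_of_tendsto_midpoint a b x y hxy ha hb] with δ h hne
  exact nonempty_hexMidEdgeSAW_of_preconnected (Λ' δ) (a δ) (b δ) h.1 h.2.1 h.2.2 hne

end Summit.CriticalPhenomena.SAWScalingLimit.Theorems.PolygonParitySqueeze

end
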